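import Mathlib.RingTheory.TensorProduct.Basic
import Mathlib.LinearAlgebra.Charpoly.Basic
import Mathlib.Algebra.Polynomial.AlgebraMap
import Mathlib.Algebra.BigOperators.Finprod
import Mathlib.FieldTheory.IntermediateField.Basic
import Mathlib.RingTheory.Ideal.Operations
import HarnessLib

/-!
# Rapoport–Smithling–Zhang 2020, Appendix B «Local models in the case of banal signature» — statement carpet

M. Rapoport, B. Smithling, W. Zhang, *Arithmetic diagonal cycles on unitary Shimura varieties*, Compositio Math. 156 (2020)
= arXiv 1710.06962 v6 [RapoportSmithlingZhang2020Diagonal], Appendix B, v6 pp. 58–60 (source of record: the cell's v6 page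
text `F0/P6/lit1/RSZ2020-v6-pages.txt` + item map 15cc0883; «p. N» = arXiv v6 page). Carpet-typing squad TKR (cell
hodgecm-mathlib, seat TKR-t05, third block (b)): STATEMENTS ONLY — definitions with bodies and named facts `RSZ2020_B_…`; no
proof, no `sorry`, no `axiom`, no `instance`, no notation.

## The print (verbatim extracts, v6 pp. 58–60)

«In this appendix, we prove that local models attached to Weil restrictions of `GL_n` and `GU_n`, defined using an analog of
the Eisenstein condition of [48], are trivial in the case of banal signature. Let `L/K` be a finite separable extension of
discretely valued henselian fields, with respective valuation rings `O_L` and `O_K`. Let `π` be a uniformizer for `L`, and fix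
an algebraic closure `K̄` of `K`.» (p. 58) · B.1 «The `GL_n` case. Let `n` be a positive integer, and fix a function (B.1)
`r : Hom_K(L, K̄) → {0, n}`, `φ ↦ r_φ`. The reflex field attached to `r` is the fixed field `E_r ⊂ K̄` of the subgroup
`{σ ∈ Gal(K̄/K) ∣ r_{σφ} = r_φ for all φ ∈ Hom_K(L, K̄)}`. […] Let `𝓛` be a periodic `O_L`-lattice chain in `L^n`. The local
model […] is the scheme `M = M_{Res_{L/K} GL_n, r, 𝓛}` over `Spec O_{E_r}` representing the following functor. To each
`O_{E_r}`-scheme `S`, the functor associates the set of isomorphism classes of families `(Λ ⊗_{O_K} O_S ↠ P_Λ)_{Λ ∈ 𝓛}` such that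
for each `Λ`, `P_Λ` is an `O_L ⊗_{O_K} O_S`-linear quotient of `Λ ⊗_{O_K} O_S`, locally free on `S` as an `O_S`-module; […] and
for each `Λ`, `P_Λ` satisfies the Kottwitz condition (B.2) `char_{O_S}(a ⊗ 1 ∣ P_Λ) = ∏_{φ ∈ Hom_K(L, K̄)} (T - φ(a))^{r_φ}` for
all `a ∈ O_L`. […] Let `L^t` denote the maximal unramified extension of `K` in `L`. […] For each `ψ ∈ Hom_K(L^t, K̄)`, set
`A_ψ := {φ ∣ φ|_{L^t} = ψ and r_φ = n}`, `B_ψ := {φ ∣ φ|_{L^t} = ψ and r_φ = 0}`. Further set `Q_{A_ψ}(T) := ∏_{φ ∈ A_ψ} (T - φ(π))`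
and `Q_{B_ψ}(T) := ∏_{φ ∈ B_ψ} (T - φ(π))`. […] there is a natural isomorphism (B.3) `O_{L^t} ⊗_{O_K} O_S ⥲ ∏_{ψ} O_S` whose
`ψ`-component is `ψ ⊗ id`. This induces a decomposition, for each `Λ`, (B.4) `P_Λ ⥲ ⊕_ψ (P_Λ)_ψ`. The Eisenstein condition is
that, for each `Λ`, (B.5) `Q_{A_ψ}(π ⊗ 1)|_{(P_Λ)_ψ} = 0` for all `ψ`. […] Lemma B.1. Let `S` be an `O_{E_r L̃^t}`-scheme. Then
`M(S)` consists of a single point.» (p. 59) · «Proof. It suffices to consider the case that `𝓛` consists of the homothety class of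
a single lattice `Λ` […] the Eisenstein condition forces (B.6) `(P_Λ)_ψ = (Λ ⊗_{O_K} O_S)_ψ / Q_{A_ψ}(π ⊗ 1)·(Λ ⊗_{O_K} O_S)_ψ`
[…] it follows by descent that `M ≅ Spec O_{E_r}`. […] Remark B.2. In the special case `n = 1` […] the Eisenstein condition is
redundant […] also […] in the unramified case. Lemma B.3. Suppose that `L/K` is unramified. Then the Kottwitz condition (B.2) on
`P_Λ` implies the Eisenstein condition (B.5). Proof. When `L = L^t` is unramified over `K`, then all sets `A_ψ` have at most one
element. If `A_ψ` is empty, then `(P_Λ)_ψ = 0` and the condition (B.5) is empty. If `A_ψ` is non-empty, then the condition (B.5)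
is equivalent to the definition of the `ψ`-eigenspace in the decomposition (B.4).» · B.2 «The unitary case […] `p ≠ 2` […] the
local model attached to `Res_{L₀/K} GU(h)`, `r`, `𝓛` is by definition the closed subscheme […] defined by the additional
condition […] the perfect pairing […] identifies `ker[Λ ⊗ O_S ↠ P_Λ]^⊥` with `ker[Λ^⊥ ⊗ O_S ↠ P_{Λ^⊥}]`. It is a trivial consequence
of Lemma B.1 that this additional condition is redundant […] Lemma B.4. `M_{Res_{L₀/K} GU(h), r, 𝓛} ≅ Spec O_{E_r}`.» (p. 60)

## What is TYPED here, and how (every deviation is a SPECIALISATION, recorded)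

The READING is the one of the printed proof of Lemma B.1: a single lattice `Λ = O_L^n` and an affine base `S = Spec R`.
* The embedding sets are abstract finite index types: `ι` for `Hom_K(L, K̄)`, `κ` for `Hom_K(L^t, K̄)`, with the restriction map
  `res : ι → κ` (`φ ↦ φ|_{L^t}`). `-- TODO(general form):` the field-theoretic construction of these sets; only `reflexFieldSet`
  (`E_r`, B.1) is typed over actual fields `K ⊆ L`, `K̄ = Ω`.
* `O_K → O_S` and the maps `φ : O_L → O_S` are data `θ : ι → (O_L →+* R)` (available when `S` is over `O_{L̃}`, the normal
  closure — stronger than the print's `O_{E_r L̃^t}`; `-- TODO(general form)`), the decomposition (B.3) is data `e : κ → R ⊗ O_L`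
  (idempotents) with its defining property `IsDecompositionB3` stated for `L = L^t` (the unramified case of Lemma B.3).
* A point of `M(S)` is given by explicit binders (an `R ⊗_{O_K} O_L`-module `P`, finite free over `R` = «locally free» on an
  affine local base, and a surjection `q` from `(R ⊗_{O_K} O_L)^n = Λ ⊗_{O_K} O_S`; no structure, no instance); (B.2)
  `KottwitzCondition`, (B.4)
  `component`, (B.5) `EisensteinCondition`, (B.6) `eisensteinKernel`, (B.1) `IsBanal`, `ASet`∕`BSet`∕`QPoly` are typed as printed.
* FACTS: **Lemma B.3** (`RSZ2020_B_3`, unramified case `κ = ι`, under the (B.3) property of `e`, the separation of distinct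
  embeddings by a unit — automatic for `L/K` unramified and `S` over `O_{L̃}` — and `R ≠ 0`), and **Lemma B.1 in the unramified
  banal case** (`RSZ2020_B_1_unramified`: every point has the kernel (B.6), i.e. «`M(S)` consists of a single point» up to the
  unique isomorphism of quotients). `-- TODO(general form):` Lemma B.1 for ramified `L/K` (needs `O_L ⊗_{O_{L^t}} O_S ≅
  O_S[T]/(Eisenstein polynomial)`), Remark B.2 (`n = 1`), and the unitary variant B.2 ∕ **Lemma B.4** (needs the
  `tr_{L/K}(ϑ⁻¹ζ h)`-pairing and self-dual lattice chains) are NOT typed.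

## References

* [RapoportSmithlingZhang2020Diagonal] App. B, v6 pp. 58–60; [48] = Rapoport–Zink 2017 (the Eisenstein condition (8.2)).
-/

noncomputable section

open scoped TensorProduct
open Polynomial

namespace Literature.AlgebraicGeometry.ShimuraVarieties.RapoportSmithlingZhang2020.AppBLocalModelsBanalSignature

universe u

/-! ## B.1 (p. 59): banal `r`, the reflex field `E_r`, the sets `A_ψ`, `B_ψ` and the polynomials `Q_{A_ψ}`, `Q_{B_ψ}` -/

/-- (B.1) «fix a function `r : Hom_K(L, K̄) → {0, n}`, `φ ↦ r_φ`» (p. 59) — BANAL signature: every `r_φ` is `0` or `n`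
(`ι` = the finite set `Hom_K(L, K̄)`). [cite: RapoportSmithlingZhang2020Diagonal, App. B (B.1) p. 59] -/
def IsBanal {ι : Type u} (n : ℕ) (r : ι → ℕ) : Prop := ∀ φ, r φ = 0 ∨ r φ = n

/-- «The reflex field attached to `r` is the fixed field `E_r ⊂ K̄` of the subgroup
`{σ ∈ Gal(K̄/K) ∣ r_{σφ} = r_φ for all φ ∈ Hom_K(L, K̄)}`» (p. 59), as a subset of an algebraically closed `Ω ⊇ K` playing `K̄`
(`Gal(K̄/K)` = `Ω ≃ₐ[K] Ω`): the elements fixed by every such `σ`. [cite: RapoportSmithlingZhang2020Diagonal, App. B B.1 p. 59] -/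
def reflexFieldSet (K L Ω : Type u) [Field K] [Field L] [Algebra K L] [Field Ω] [Algebra K Ω]
    (r : (L →ₐ[K] Ω) → ℕ) : Set Ω :=
  {x | ∀ σ : Ω ≃ₐ[K] Ω, (∀ φ : L →ₐ[K] Ω, r ((σ : Ω →ₐ[K] Ω).comp φ) = r φ) → σ x = x}

/-- «`A_ψ := {φ ∈ Hom_K(L, K̄) ∣ φ|_{L^t} = ψ and r_φ = n}`» (p. 59), with `res : ι → κ` the restriction `φ ↦ φ|_{L^t}`.
[cite: RapoportSmithlingZhang2020Diagonal, App. B B.1 p. 59] -/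
def ASet {ι κ : Type u} (n : ℕ) (r : ι → ℕ) (res : ι → κ) (ψ : κ) : Set ι := {φ | res φ = ψ ∧ r φ = n}

/-- «`B_ψ := {φ ∈ Hom_K(L, K̄) ∣ φ|_{L^t} = ψ and r_φ = 0}`» (p. 59). [cite: RapoportSmithlingZhang2020Diagonal, App. B B.1 p. 59] -/
def BSet {ι κ : Type u} (r : ι → ℕ) (res : ι → κ) (ψ : κ) : Set ι := {φ | res φ = ψ ∧ r φ = 0}

/-- «`Q_{A_ψ}(T) := ∏_{φ ∈ A_ψ} (T - φ(π))` and `Q_{B_ψ}(T) := ∏_{φ ∈ B_ψ} (T - φ(π))` […] polynomials with coefficients in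
`O_{E_r L̃^t}`» (p. 59), read in `O_S = R`: for a finite set `A` of embeddings and the values `c φ = φ(π) ∈ R`, the polynomial
`∏_{φ ∈ A} (T - c_φ) ∈ R[T]` (a `finprod`). [cite: RapoportSmithlingZhang2020Diagonal, App. B B.1 p. 59] -/
def QPoly {ι : Type u} {R : Type u} [CommRing R] (c : ι → R) (A : Set ι) : R[X] := ∏ᶠ φ ∈ A, (X - C (c φ))

/-! ## The points of the local model over an affine base (single lattice `Λ = O_L^n`, p. 59) -/

/-! A point of «the following functor» (p. 59) over `S = Spec R`, for the single lattice `Λ = O_L^n` (as in the proof of Lemma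
B.1): «`P_Λ` is an `O_L ⊗_{O_K} O_S`-linear quotient of `Λ ⊗_{O_K} O_S`, locally free on `S` as an `O_S`-module» — an
`R ⊗_{O_K} O_L`-module `P` with the compatible `R`-structure (`IsScalarTower`), finite free over `R` (the affine-local reading of
«locally free»), and a surjection `q : (R ⊗_{O_K} O_L)^n ↠ P`. No structure is bundled: the data are explicit binders below. -/

section Point

variable {OK OL R : Type u} [CommRing OK] [CommRing OL] [Algebra OK OL] [CommRing R] [Algebra OK R]

/-- The `O_S`-linear endomorphism «`t ∣ P_Λ`» of `P_Λ` given by an element `t ∈ O_L ⊗_{O_K} O_S` (e.g. `t = a ⊗ 1`, (B.2), or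
`t = Q_{A_ψ}(π ⊗ 1)`, (B.5)). [cite: RapoportSmithlingZhang2020Diagonal, App. B (B.2) p. 59] -/
def act (P : Type u) [AddCommGroup P] [Module (R ⊗[OK] OL) P] [Module R P] [IsScalarTower R (R ⊗[OK] OL) P]
    (t : R ⊗[OK] OL) : P →ₗ[R] P where
  toFun x := t • x
  map_add' x y := smul_add t x y
  map_smul' c x := smul_algebra_smul_comm c t x

/-- **(B.2) the Kottwitz condition** «`char_{O_S}(a ⊗ 1 ∣ P_Λ) = ∏_{φ ∈ Hom_K(L, K̄)} (T - φ(a))^{r_φ}` for all `a ∈ O_L`» (p. 59),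
for `P_Λ` finite free over `O_S = R`, with `φ(a) ∈ O_S` given by the structure maps `θ φ : O_L → R`.
[cite: RapoportSmithlingZhang2020Diagonal, App. B (B.2) p. 59] -/
def KottwitzCondition (P : Type u) [AddCommGroup P] [Module (R ⊗[OK] OL) P] [Module R P] [IsScalarTower R (R ⊗[OK] OL) P]
    [Module.Free R P] [Module.Finite R P] {ι : Type u} [Fintype ι] (r : ι → ℕ) (θ : ι → (OL →+* R)) : Prop :=
  ∀ a : OL, (act P ((1 : R) ⊗ₜ[OK] a)).charpoly = ∏ φ, (X - C (θ φ a)) ^ r φ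

/-- (B.4) «`P_Λ ⥲ ⊕_{ψ} (P_Λ)_ψ`»: the `ψ`-component `(P_Λ)_ψ = e_ψ·P_Λ` cut out by the idempotent `e_ψ ∈ O_L ⊗_{O_K} O_S` of the
decomposition (B.3). [cite: RapoportSmithlingZhang2020Diagonal, App. B (B.4) p. 59] -/
def component (P : Type u) [AddCommGroup P] [Module (R ⊗[OK] OL) P] [Module R P] [IsScalarTower R (R ⊗[OK] OL) P]
    {κ : Type u} (e : κ → R ⊗[OK] OL) (ψ : κ) : Submodule R P := LinearMap.range (act P (e ψ))

/-- **(B.5) the Eisenstein condition** «`Q_{A_ψ}(π ⊗ 1)|_{(P_Λ)_ψ} = 0` for all `ψ ∈ Hom_K(L^t, K̄)`» (p. 59): the polynomial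
`Q_{A_ψ}` (coefficients `φ(π) = θ φ π ∈ R`) evaluated at the endomorphism `π ⊗ 1` kills the `ψ`-component.
[cite: RapoportSmithlingZhang2020Diagonal, App. B (B.5) p. 59] -/
def EisensteinCondition (P : Type u) [AddCommGroup P] [Module (R ⊗[OK] OL) P] [Module R P] [IsScalarTower R (R ⊗[OK] OL) P]
    {ι κ : Type u} (n : ℕ) (r : ι → ℕ) (res : ι → κ) (θ : ι → (OL →+* R)) (π : OL) (e : κ → R ⊗[OK] OL) : Prop :=
  ∀ (ψ : κ), ∀ x ∈ component P e ψ,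
    Polynomial.aeval (act P ((1 : R) ⊗ₜ[OK] π)) (QPoly (fun φ => θ φ π) (ASet n r res ψ)) x = 0

end Point

/-- (B.6) «`(P_Λ)_ψ = (Λ ⊗_{O_K} O_S)_ψ / Q_{A_ψ}(π ⊗ 1)·(Λ ⊗_{O_K} O_S)_ψ`» (p. 60): the kernel this forces, i.e. the submodule
`Σ_ψ Q_{A_ψ}(π ⊗ 1)·e_ψ·(Λ ⊗_{O_K} O_S)` of `(R ⊗_{O_K} O_L)^n`. [cite: RapoportSmithlingZhang2020Diagonal, App. B (B.6) p. 60] -/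
def eisensteinKernel {OK OL R : Type u} [CommRing OK] [CommRing OL] [Algebra OK OL] [CommRing R] [Algebra OK R]
    {ι κ : Type u} (n : ℕ) (r : ι → ℕ) (res : ι → κ) (θ : ι → (OL →+* R)) (π : OL) (e : κ → R ⊗[OK] OL) :
    Submodule (R ⊗[OK] OL) (Fin n → R ⊗[OK] OL) :=
  Ideal.span (Set.range fun ψ : κ =>
      Polynomial.aeval (1 ⊗ₜ[OK] π : R ⊗[OK] OL) (QPoly (fun φ => θ φ π) (ASet n r res ψ)) * e ψ) •
    (⊤ : Submodule (R ⊗[OK] OL) (Fin n → R ⊗[OK] OL))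

/-- (B.3) «there is a natural isomorphism `O_{L^t} ⊗_{O_K} O_S ⥲ ∏_{ψ ∈ Hom_K(L^t, K̄)} O_S` whose `ψ`-component is `ψ ⊗ id`»
(p. 59), in the UNRAMIFIED case `L = L^t` (so `κ = ι`), as the property of the idempotents `e_ψ ∈ O_S ⊗_{O_K} O_L` it provides: a
complete orthogonal family on which `1 ⊗ a` acts through `ψ(a)`. [cite: RapoportSmithlingZhang2020Diagonal, App. B (B.3) p. 59] -/
def IsDecompositionB3 {OK OL R : Type u} [CommRing OK] [CommRing OL] [Algebra OK OL] [CommRing R] [Algebra OK R]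
    {ι : Type u} [Fintype ι] (θ : ι → (OL →+* R)) (e : ι → R ⊗[OK] OL) : Prop :=
  (∑ ψ, e ψ = 1) ∧ (∀ ψ, e ψ * e ψ = e ψ) ∧ (∀ ψ ψ', ψ ≠ ψ' → e ψ * e ψ' = 0) ∧
    ∀ (ψ : ι) (a : OL), (1 ⊗ₜ[OK] a) * e ψ = algebraMap R (R ⊗[OK] OL) (θ ψ a) * e ψ

/-- **Lemma B.3** «Suppose that `L/K` is unramified. Then the Kottwitz condition (B.2) on `P_Λ` implies the Eisenstein condition
(B.5)» (p. 60; proof: «all sets `A_ψ` have at most one element. If `A_ψ` is empty, then `(P_Λ)_ψ = 0` […] If `A_ψ` is non-empty,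
then the condition (B.5) is equivalent to the definition of the `ψ`-eigenspace»), in the typed reading: `κ = ι`, `res = id`,
banal `r`, `e` the (B.3) decomposition, distinct embeddings separated by a unit at some `a ∈ O_L` (as for an unramified `L/K`
over `S → Spec O_{L̃}`), `R ≠ 0`. [cite: RapoportSmithlingZhang2020Diagonal, App. B Lemma B.3 p. 60] -/
def RSZ2020_B_3 : Prop :=
  ∀ (OK OL R : Type u) [CommRing OK] [CommRing OL] [Algebra OK OL] [CommRing R] [Algebra OK R] [Nontrivial R]
    (ι : Type u) [Fintype ι] (n : ℕ) (r : ι → ℕ) (θ : ι → (OL →+* R)) (π : OL) (e : ι → R ⊗[OK] OL)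
    (P : Type u) [AddCommGroup P] [Module (R ⊗[OK] OL) P] [Module R P] [IsScalarTower R (R ⊗[OK] OL) P]
    [Module.Free R P] [Module.Finite R P] (q : (Fin n → R ⊗[OK] OL) →ₗ[R ⊗[OK] OL] P),
    Function.Surjective q → 0 < n → IsBanal n r → IsDecompositionB3 θ e →
      (∃ a : OL, ∀ ψ ψ', ψ ≠ ψ' → IsUnit (θ ψ a - θ ψ' a)) →
        KottwitzCondition (OK := OK) P r θ → EisensteinCondition P n r id θ π e

/-- **Lemma B.1** «Let `S` be an `O_{E_r L̃^t}`-scheme. Then `M(S)` consists of a single point» with its proof «the Eisenstein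
condition forces (B.6)» (pp. 59–60), in the UNRAMIFIED BANAL reading (`κ = ι`; single lattice `Λ = O_L^n`, `O_L` free of rank
`|Hom_K(L, K̄)|` over `O_K`, affine `S = Spec R ≠ ∅` over `O_{L̃}`, `e` the (B.3) decomposition, embeddings separated by a unit):
every point satisfying (B.2) (hence (B.5), Lemma B.3) has kernel exactly the submodule (B.6) — so any two points are identified
by the unique isomorphism of quotients. `-- TODO(general form): ramified L/K.`
[cite: RapoportSmithlingZhang2020Diagonal, App. B Lemma B.1 pp. 59–60] -/
def RSZ2020_B_1_unramified : Prop :=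
  ∀ (OK OL R : Type u) [CommRing OK] [CommRing OL] [Algebra OK OL] [Module.Free OK OL] [CommRing R] [Algebra OK R]
    [Nontrivial R] (ι : Type u) [Fintype ι] (n : ℕ) (r : ι → ℕ) (θ : ι → (OL →+* R)) (π : OL) (e : ι → R ⊗[OK] OL)
    (P : Type u) [AddCommGroup P] [Module (R ⊗[OK] OL) P] [Module R P] [IsScalarTower R (R ⊗[OK] OL) P]
    [Module.Free R P] [Module.Finite R P] (q : (Fin n → R ⊗[OK] OL) →ₗ[R ⊗[OK] OL] P),
    Function.Surjective q → 0 < n → Module.finrank OK OL = Fintype.card ι → IsBanal n r → IsDecompositionB3 θ e →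
      (∃ a : OL, ∀ ψ ψ', ψ ≠ ψ' → IsUnit (θ ψ a - θ ψ' a)) → KottwitzCondition (OK := OK) P r θ →
        LinearMap.ker q = eisensteinKernel n r id θ π e

end Literature.AlgebraicGeometry.ShimuraVarieties.RapoportSmithlingZhang2020.AppBLocalModelsBanalSignature

end
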